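import Mathlib

/-!
# Aoki's quotient `B_q/(S_q + D_q)` at explicit levels — kernel certificates (part 1: definitions, the sparse `B_q`-criterion, `σ_t`, the decomposition lemma)

The objects are Aoki's (Math. Ann. 266 (1983), pp. 25–26, 36, as the cell's records transcribe them):
`R_q` = the free abelian group on `ℤ/q ∖ {0}`, here `Fin (q-1) → ℤ` with index `a - 1 ↔ (a)`;
`θ_t(α) = Σ_a c_a (⟨t·a/q⟩ − 1/2)` for units `t`, here scaled by `2q`: `thetaN q t a = 2·((t·a) mod q) − q`;
`B_q = Ker θ`; the standard elements `σ_{p,i}`; `D_q` spanned by the pairs `(a) + (−a)` (and `(q/2)`);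
`S_q + D_q` = the `ℤ`-span of all standard elements and pairs (the `ℤ[G_q]`-span, since `G_q` permutes them).
Part 1 defines everything and proves the generic lemmas that need no certificate data.
-/

namespace HodgeRepro0.P6AokiQuotient

/-- The units of `ℤ/q`, as naturals in `(0, q)`. -/
def unitsList (q : ℕ) : List ℕ := (List.range q).filter (fun t => Nat.gcd t q = 1)

/-- `2q·(⟨t·a/q⟩ − 1/2) = 2·((t·a) mod q) − q` for a natural index `a`. -/
def thetaN (q t a : ℕ) : ℤ := 2 * (((t * a) % q : ℕ) : ℤ) - (q : ℤ)

/-- The θ-coefficient at the basis element `(a+1)` of `R_q`. -/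
def theta (q t : ℕ) (a : Fin (q - 1)) : ℤ := thetaN q t (a.val + 1)

/-- Membership in `B_q = Ker θ`: every unit row kills the vector. -/
def memB (q : ℕ) (v : Fin (q - 1) → ℤ) : Prop := ∀ t ∈ unitsList q, ∑ a, theta q t a * v a = 0

/-- The vector `Σ_{a ∈ es} (a)` of `R_q` (entries counted with multiplicity). -/
def vecOf (q : ℕ) (es : List ℕ) : Fin (q - 1) → ℤ := fun i => (es.count (i.val + 1) : ℤ)

/-- Dense vector from a list of coefficients (index `a-1 ↔ (a)`). -/
def toV (n : ℕ) (l : List ℤ) : Fin n → ℤ := fun i => l.getD i.val 0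

/-- A sum over `Fin n` as a list sum over `List.range n`. -/
theorem sum_fin_eq_list (n : ℕ) (g : ℕ → ℤ) : ∑ i : Fin n, g i.val = ((List.range n).map g).sum := by
  induction n with
  | zero => simp
  | succ n ih =>
    rw [Fin.sum_univ_castSucc, List.range_succ, List.map_append, List.sum_append]
    simp [ih]

/-- Weighted count identity: `Σ_i g(i+1)·count_{es}(i+1) = Σ_{a ∈ es} g a` for entries in `1..q-1`. -/
theorem sum_mul_vecOf (q : ℕ) (g : ℕ → ℤ) (es : List ℕ) (hes : ∀ a ∈ es, 1 ≤ a ∧ a ≤ q - 1) :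
    ∑ i : Fin (q - 1), g (i.val + 1) * vecOf q es i = (es.map g).sum := by
  induction es with
  | nil => simp [vecOf]
  | cons x es ih =>
    have hx := hes x (List.mem_cons_self ..)
    have ih := ih (fun a ha => hes a (List.mem_cons_of_mem _ ha))
    simp only [vecOf, List.count_cons, List.map_cons, List.sum_cons] at ih ⊢
    push_cast
    simp only [mul_add, Finset.sum_add_distrib]
    rw [ih, add_comm]
    congr 1
    rw [Finset.sum_eq_single ⟨x - 1, by omega⟩]
    · simp [show x - 1 + 1 = x by omega]
    · intro i _ hi
      have : ¬ (x = i.val + 1) := by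
        intro h; apply hi; ext; simp; omega
      simp [this]
    · simp

/-- Sparse criterion for `B_q`-membership of `Σ_{a ∈ es} (a)`. -/
theorem memB_vecOf (q : ℕ) (es : List ℕ) (hes : ∀ a ∈ es, 1 ≤ a ∧ a ≤ q - 1)
    (h : ∀ t ∈ unitsList q, (es.map (thetaN q t)).sum = 0) : memB q (vecOf q es) := by
  intro t ht
  have := sum_mul_vecOf q (thetaN q t) es hes
  simp only [theta]
  rw [this]; exact h t ht

/-- A 0/1-valued list sum is a count. -/
theorem sum_map_ite_eq_countP (es : List ℕ) (P : ℕ → Prop) [DecidablePred P] :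
    (es.map (fun x => if P x then (1 : ℤ) else 0)).sum = (es.countP (fun x => decide (P x)) : ℤ) := by
  induction es with
  | nil => simp
  | cons x es ih =>
    simp only [List.map_cons, List.sum_cons, List.countP_cons, ih]
    by_cases h : P x
    · simp [h, add_comm]
    · simp [h]


/-- The entry lists of the `p`-standard elements `σ_{p,i} = (i, d+i, …, (p−1)d+i, q − pi)`, `d = q/p`. -/
def stdEntries (q p i : ℕ) : List ℕ := ((List.range p).map (fun j => (j * (q / p) + i) % q)) ++ [(q - (p * i) % q) % q]

/-- The entry list of the `2`-standard element `σ_{2,i} = (i, q/2 + i, q − 2i, q/2)`. -/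
def std2Entries (q i : ℕ) : List ℕ := [i % q, (q / 2 + i) % q, (q - (2 * i) % q) % q, q / 2]

/-- Admissibility of `i` for the prime `p`: `i ∈ ℤ/q ∖ {0}` with `p·i ≠ 0` and, for even `q`, `p·i ≠ q/2`. -/
def admissibleP (q p i : ℕ) : Bool := i ≠ 0 && (p * i) % q ≠ 0 && (q % 2 ≠ 0 || (p * i) % q ≠ q / 2)

/-- The admissible `i < q` for the prime `p`. -/
def admissible (q p : ℕ) : List ℕ := (List.range q).filter (admissibleP q p)

/-- The prime divisors of `q` (computably: `2 ≤ p`, `p ∣ q`, no divisor in `[2, p)`). -/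
def primeDivisors (q : ℕ) : List ℕ :=
  (List.range (q + 1)).filter (fun p => 2 ≤ p ∧ p ∣ q ∧ ∀ m < p, 2 ≤ m → ¬ m ∣ p)

/-- The odd prime divisors of `q`. -/
def oddPrimeDivisors (q : ℕ) : List ℕ := (primeDivisors q).filter (fun p => p ≠ 2)

/-- Entry lists of all standard elements of level `q`: odd primes `p ∣ q`, and `p = 2` when `4 ∣ q`. -/
def stdEntriesList (q : ℕ) : List (List ℕ) :=
  (oddPrimeDivisors q).flatMap (fun p => (admissible q p).map (fun i => stdEntries q p i))
  ++ (if q % 4 = 0 then (admissible q 2).map (fun i => std2Entries q i) else [])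

/-- Entry lists of the generators of `D_q`: the pairs `(a) + (q − a)`, `1 ≤ a ≤ (q−1)/2`, and `(q/2)` for even `q`. -/
def pairEntriesList (q : ℕ) : List (List ℕ) :=
  ((List.range ((q - 1) / 2)).map (fun j => [j + 1, q - (j + 1)])) ++ (if q % 2 = 0 then [[q / 2]] else [])

/-- All generator entry lists of `S_q + D_q`. -/
def genEntries (q : ℕ) : List (List ℕ) := stdEntriesList q ++ pairEntriesList q

/-- The generating set of `S_q + D_q` in `R_q`. -/
def genSet (q : ℕ) : Set (Fin (q - 1) → ℤ) := {v | ∃ es ∈ genEntries q, v = vecOf q es}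

/-- `S_q + D_q` as a `ℤ`-submodule of `R_q`. -/
def SD (q : ℕ) : Submodule ℤ (Fin (q - 1) → ℤ) := Submodule.span ℤ (genSet q)

/-- `B_q` as a `ℤ`-submodule of `R_q`. -/
def B (q : ℕ) : Submodule ℤ (Fin (q - 1) → ℤ) where
  carrier := {v | memB q v}
  zero_mem' := by intro t _; simp
  add_mem' := by
    intro u v hu hv t ht
    have := hu t ht; have := hv t ht
    simp only [Pi.add_apply, mul_add, Finset.sum_add_distrib]; omega
  smul_mem' := by
    intro c v hv t ht
    have := hv t ht
    simp only [Pi.smul_apply, smul_eq_mul, mul_left_comm _ c, ← Finset.mul_sum, this, mul_zero]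

/-- Membership in the submodule `B q` is `memB`. -/
theorem mem_B {q : ℕ} {v : Fin (q - 1) → ℤ} : v ∈ B q ↔ memB q v := Iff.rfl

/-- `S_q + D_q ⊆ B_q` follows from the two decidable facts on the generator entry lists. -/
theorem SD_le_B (q : ℕ) (hbound : ∀ es ∈ genEntries q, ∀ a ∈ es, 1 ≤ a ∧ a ≤ q - 1)
    (hθ : ∀ es ∈ genEntries q, ∀ t ∈ unitsList q, (es.map (thetaN q t)).sum = 0) : SD q ≤ B q := by
  apply Submodule.span_le.mpr
  rintro v ⟨es, hes, rfl⟩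
  exact memB_vecOf q es (hbound es hes) (hθ es hes)

/-- The pushforward action `σ_t (Σ c_a (a)) = Σ c_a (ta)` of `t` on `R_q`. -/
def sigma (q t : ℕ) (v : Fin (q - 1) → ℤ) : Fin (q - 1) → ℤ :=
  fun b => ∑ a, if (t * (a.val + 1)) % q = b.val + 1 then v a else 0

/-- `σ_t` as a linear map. -/
def sigmaL (q t : ℕ) : (Fin (q - 1) → ℤ) →ₗ[ℤ] (Fin (q - 1) → ℤ) where
  toFun := sigma q t
  map_add' := by
    intro u v; funext b; simp only [sigma, Pi.add_apply]
    rw [← Finset.sum_add_distrib]; apply Finset.sum_congr rfl; intro a _; split_ifs <;> simp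
  map_smul' := by
    intro c v; funext b; simp only [sigma, Pi.smul_apply, smul_eq_mul, RingHom.id_apply]
    rw [Finset.mul_sum]; apply Finset.sum_congr rfl; intro a _; split_ifs <;> simp

/-- `sigmaL` applies as `sigma`. -/
theorem sigmaL_apply (q t : ℕ) (v : Fin (q - 1) → ℤ) : sigmaL q t v = sigma q t v := rfl

/-- `σ_t` of `Σ_{a ∈ es} (a)` is `Σ_{a ∈ es} (ta)`. -/
theorem sigma_vecOf (q t : ℕ) (es : List ℕ) (hes : ∀ a ∈ es, 1 ≤ a ∧ a ≤ q - 1) :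
    sigma q t (vecOf q es) = vecOf q (es.map (fun a => (t * a) % q)) := by
  funext b
  simp only [sigma]
  have h1 : (∑ a, if (t * (a.val + 1)) % q = b.val + 1 then vecOf q es a else 0)
      = ∑ a : Fin (q - 1), (if (t * (a.val + 1)) % q = b.val + 1 then (1 : ℤ) else 0) * vecOf q es a :=
    Finset.sum_congr rfl (fun a _ => by split_ifs <;> simp)
  have key := sum_mul_vecOf q (fun x => if (t * x) % q = b.val + 1 then (1 : ℤ) else 0) es hes
  rw [h1, key, sum_map_ite_eq_countP]
  simp only [vecOf, List.count_eq_countP, List.countP_map]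
  congr 2

/-- `vecOf` depends only on the multiset of entries. -/
theorem vecOf_perm (q : ℕ) {es es' : List ℕ} (h : es.Perm es') : vecOf q es = vecOf q es' := by
  funext i; simp [vecOf, h.count_eq]


/-- Membership in `admissible` is the computable predicate on `i < q`. -/
theorem mem_admissible {q p i : ℕ} : i ∈ admissible q p ↔ i < q ∧ admissibleP q p i = true := by
  simp [admissible, List.mem_filter, List.mem_range]

/-- A standard element's entry list lies in `stdEntriesList` for admissible data. -/
theorem stdEntries_mem {q p i : ℕ} (hp : p ∈ oddPrimeDivisors q) (hi : i ∈ admissible q p) :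
    stdEntries q p i ∈ stdEntriesList q := by
  simp only [stdEntriesList, List.mem_append, List.mem_flatMap, List.mem_map]
  exact Or.inl ⟨p, hp, i, hi, rfl⟩

/-- A `2`-standard element's entry list lies in `stdEntriesList` when `4 ∣ q`. -/
theorem std2Entries_mem {q i : ℕ} (h4 : q % 4 = 0) (hi : i ∈ admissible q 2) :
    std2Entries q i ∈ stdEntriesList q := by
  simp only [stdEntriesList, List.mem_append, List.mem_map, h4, if_true]
  exact Or.inr ⟨i, hi, rfl⟩

/-- A pair entry list lies in `pairEntriesList`. -/
theorem pair_mem {q j : ℕ} (hj : j < (q - 1) / 2) : [j + 1, q - (j + 1)] ∈ pairEntriesList q := by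
  simp only [pairEntriesList, List.mem_append, List.mem_map, List.mem_range]
  exact Or.inl ⟨j, hj, rfl⟩

/-- The entry list `[q/2]` lies in `pairEntriesList` for even `q`. -/
theorem half_mem {q : ℕ} (h : q % 2 = 0) : [q / 2] ∈ pairEntriesList q := by
  simp [pairEntriesList, h]

/-- Generators lie in `S_q + D_q`. -/
theorem vecOf_mem_SD {q : ℕ} {es : List ℕ} (h : es ∈ genEntries q) : vecOf q es ∈ SD q :=
  Submodule.subset_span ⟨es, h, rfl⟩

/-- If `σ_t` sends every generator's entry list to a permutation of a generator's entry list,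
then `σ_t(S_q + D_q) ⊆ S_q + D_q`. -/
theorem sigma_SD_le (q t : ℕ) (hbound : ∀ es ∈ genEntries q, ∀ a ∈ es, 1 ≤ a ∧ a ≤ q - 1)
    (hperm : ∀ es ∈ genEntries q, ∃ es' ∈ genEntries q, (es.map (fun a => (t * a) % q)).Perm es') :
    Submodule.map (sigmaL q t) (SD q) ≤ SD q := by
  rw [SD, Submodule.map_span_le]
  rintro v ⟨es, hes, rfl⟩
  obtain ⟨es', hes', hp⟩ := hperm es hes
  rw [sigmaL_apply, sigma_vecOf q t es (hbound es hes), vecOf_perm q hp]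
  exact vecOf_mem_SD hes'

/-- The pivot/complement certificate: if `ℓ_i (piv j) = δ_ij`, the `P`-columns of `θ` admit a left
inverse `Y` with `Y·θ_P = d·I` (`d ≠ 0`), every index is a pivot or a `P`-index, and each `ℓ_i ∈ B_q`,
then every `v ∈ B_q` equals `Σ_i v(piv i) • ℓ_i`. -/
theorem decompose (q : ℕ) {r m : ℕ} (piv : Fin r → Fin (q - 1)) (P : Fin m → Fin (q - 1))
    (ℓ : Fin r → (Fin (q - 1) → ℤ)) (Y : Fin m → Fin (unitsList q).length → ℤ) (d : ℤ) (hd : d ≠ 0)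
    (hℓ : ∀ i j, ℓ i (piv j) = if i = j then 1 else 0)
    (hY : ∀ i j, ∑ s, Y i s * theta q ((unitsList q).get s) (P j) = if i = j then d else 0)
    (hcover : ∀ a, (∃ i, piv i = a) ∨ (∃ j, P j = a))
    (hPinj : Function.Injective P)
    (hℓB : ∀ i, ℓ i ∈ B q) :
    ∀ v ∈ B q, v = ∑ i, v (piv i) • ℓ i := by
  intro v hv
  set y := v - ∑ i, v (piv i) • ℓ i with hy
  have hyB : y ∈ B q := (B q).sub_mem hv (Submodule.sum_mem _ (fun i _ => (B q).smul_mem _ (hℓB i)))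
  have hypiv : ∀ j, y (piv j) = 0 := by
    intro j
    simp only [hy, Pi.sub_apply, Finset.sum_apply, Pi.smul_apply, smul_eq_mul, hℓ, mul_ite, mul_one,
      mul_zero, Finset.sum_ite_eq', Finset.mem_univ, if_true, sub_self]
  have hyP : ∀ j, y (P j) = 0 := by
    intro j
    have h1 : ∀ s : Fin (unitsList q).length, ∑ a, theta q ((unitsList q).get s) a * y a = 0 := by
      intro s
      have hs : (unitsList q).get s ∈ unitsList q := by
        rw [List.get_eq_getElem]; exact List.getElem_mem _
      exact hyB _ hs
    have h2 : ∑ a, (∑ s, Y j s * theta q ((unitsList q).get s) a) * y a = 0 := by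
      have : ∑ a, (∑ s, Y j s * theta q ((unitsList q).get s) a) * y a
          = ∑ s, Y j s * ∑ a, theta q ((unitsList q).get s) a * y a := by
        simp only [Finset.sum_mul, Finset.mul_sum, mul_assoc]
        exact Finset.sum_comm
      rw [this]
      exact Finset.sum_eq_zero (fun s _ => by rw [h1 s, mul_zero])
    have h3 : ∀ f : Fin (q - 1) → ℤ, (∀ i, f (piv i) = 0) → ∑ a, f a = ∑ i, f (P i) := by
      intro f hf
      have hinj : ∀ x ∈ (Finset.univ : Finset (Fin m)), ∀ y ∈ (Finset.univ : Finset (Fin m)),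
          P x = P y → x = y := fun _ _ _ _ h => hPinj h
      rw [← Finset.sum_image hinj]
      symm
      apply Finset.sum_subset (Finset.subset_univ _)
      intro a _ ha
      rcases hcover a with ⟨i, hi⟩ | ⟨i, hi⟩
      · rw [← hi]; exact hf i
      · exact absurd (Finset.mem_image.mpr ⟨i, Finset.mem_univ _, hi⟩) ha
    have h4 := h3 (fun a => (∑ s, Y j s * theta q ((unitsList q).get s) a) * y a)
      (fun i => by simp only [hypiv, mul_zero])
    rw [h4] at h2
    simp only [hY, ite_mul, zero_mul, Finset.sum_ite_eq, Finset.mem_univ, if_true] at h2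
    exact (mul_eq_zero.mp h2).resolve_left hd
  have hy0 : y = 0 := by
    funext a
    rcases hcover a with ⟨i, hi⟩ | ⟨j, hj⟩
    · rw [← hi]; exact hypiv i
    · rw [← hj]; exact hyP j
  exact (sub_eq_zero.mp hy0)

end HodgeRepro0.P6AokiQuotient
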